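import Summits.ABC.IUTFork.Joshi.LogLinkInsertedIsometry
import Summits.ABC.IUTFork.Joshi.PrimitiveAnsatzPointsClassical
import Summits.ABC.IUTFork.Joshi.LogLinkTeichmullerFrobeniusModel
import Summits.ABC.IUTFork.Joshi.PrototypeJointModelInduced
import HarnessLib

/-!
# [J-IIp] §10.13 over the period-ring signature: Frobenius transport and the Witt–Teichmüller law `ϕ([a]) = [a^p]` admit NO
# `ϕ`-periodic point — so «transport at EVERY point of the carrier» ∧ `ϕ([a]) = [a^p]` is unsatisfiable as typed (located, not adjudicated)

Proof-only companion of the abc-iut cell, block E «type Joshi's construction, test vs S» (rung LADDER-ABC:A2.E; seat abc-iut-E-t50,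
gen 5 — one in-fit item in the lineage's located-signature-gap lane «W5»: E-t50 g4 AUDITED p441701 2026-08-26T12:02:38Z, E-t7 g5
CLAIM W5 12:23:11Z). Everything is over E-t3's HYPOTHESIS signature `PeriodRingDatum` (`Joshi/ThetaValuesLocus.lean`, p427971) and uses
BY NAME, restating nothing: E-t7's §10.13 input structure `PeriodRingDatum.FrobeniusTransport` (`Joshi/LogLinkFrobeniusTransport.lean`,
p430819) and `PeriodRingDatum.scale_frobY_of_transport` (`Joshi/LogLinkInsertedIsometry.lean`: under a transport at `y` and
`hφ : ∀ a, ϕ [a] = [a^p]`, `scale (ϕ y) = p · scale y`), E-t2's junk-point lemma `PeriodRingDatum.frobY_pt_one` and print's locus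
`PeriodRingDatum.classicalPts` (`Joshi/PrimitiveAnsatzPointsClassical.lean`), and E-t52's model `TeichFrobModel.datum`
(`Joshi/LogLinkTeichmullerFrobeniusModel.lean`), and E-t7 g5's W5 model `JointModel.Induced.prototypeDatum`
(`Joshi/PrototypeJointModelInduced.lean`, p446419). Source of the hypotheses: K. Joshi, arXiv:2303.01662v3 (`paper:arxiv-2303.01662`, bib
`Joshi2023ATS2Local`, UNREFEREED — typed AS A CANDIDATE by E-t3/E-t7): §10.13 p. 33 l. 1–12 «`ϕ(𝔪_{y_{n−1}}) = 𝔪_{ϕ(y_{n−1})} = 𝔪_{y_n}` …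
`ϕ([a] − p) = [ϕ(a)] − p = [a^p] − p`» (cell render p0033 l. 1–11); §6.6 p. 16 l. 27–40 («the fiber of `Y → X` over the canonical point
can be identified with … `{([ϕⁿ(t)] − p) : n ∈ ℤ}`» — a `ϕ^ℤ`-orbit). TAKES NO SIDE
on [IUTchIII] Cor. 3.12, on Joshi's claims, or on Mochizuki's reports on them; typed ≠ proved; located ≠ adjudicated; no FACT-LIST row
consumed; 0 `def`s; `hφ` and the transports stay BINDERS (nothing asserted). Object-side file (E-PLAN R14: no `Cor312*`/`Thm311*` import).

WHAT IS PROVED (kernel, for EVERY datum `D` of the signature).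
* §1 `isEmpty_frobeniusTransport_of_frobY_eq`: under `hφ`, NO `ϕ`-FIXED point carries a §10.13 transport (`scale y = p · scale y`
  contradicts `scale y > 0`); more generally `frobY_iterate_ne_self_of_transport`: if every point carries a transport and `hφ` holds,
  `ϕ` has NO PERIODIC POINT on `Y` (`scale (ϕ^[k] y) = p^k · scale y`, `scale_frobY_iterate_of_transport`) — OUR typed counterpart of
  print's §6.6 fibre description (a `ϕ^ℤ`-orbit indexed by `n ∈ ℤ`), DERIVED from §10.13 + the Witt law rather than posited.
* §2 The signature MANUFACTURES `ϕ`-fixed points: `pt` is TOTAL on `F` and `pt_frob : pt (a^p) = ϕ (pt a)` holds at EVERY `a`, so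
  `pt 1` (E-t2's `frobY_pt_one`) and `pt 0` (`frobY_pt_zero`, `0^p = 0`) are `ϕ`-fixed junk values outside print's `|Y_{F,ℚ_p}|`
  (E-t2's `classicalPts`; `pt_zero_not_mem_classicalPts`). Hence **`not_teichFrob_of_transport_everywhere`**: for EVERY datum,
  «a §10.13 transport at every point of the carrier type `Y`» and «`ϕ([a]) = [a^p]` for all `a`» are JOINTLY UNSATISFIABLE — equivalently
  `isEmpty_frobeniusTransport_pt_one` / `_pt_zero` under `hφ`. LOCATED SIGNATURE ARTEFACT (for the block-E VACUITY column, cf. E-t50 g4's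
  W5 «no field ties `frob` to `frobY`»): the consistent, print-shaped form of the §10.13 package is «transport at every point of
  `classicalPts` ∧ `hφ`» (print's `|Y|` has no junk points), NOT «transport at every `y : Y` ∧ `hφ`». A certificate of «transport at
  every `y : Y`» (e.g. a pull-back model `B = (Y → Q̄_p)`, `ϕ b = b ∘ ϕ_Y⁻¹`) therefore REFUTES `hφ` at that model — not a defect of such
  a certificate, a boundary of what the typed signature can carry jointly. Repairs to list (for the planner, not adopted): (r1) state
  `pt_frob` / transports on `𝔪_F ∖ {0}` / `classicalPts` only; (r2) make `Y` the type of classical points.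
* §3 At E-t52's model of record `TeichFrobModel.datum p` (where `hφ` HOLDS, `frob_teich`, and transports are exhibited at the column
  points `Sum.inr (n+1)`): NO transport exists at its junk point `pt 1 = Sum.inl 1` nor at `pt 0` (`TeichFrobModel.isEmpty_transport_pt_one`
  / `_pt_zero`, by `exact` from §2) — the model's choice to place transports off the generic points is forced, not incidental.
* §4 At E-t7 g5's W5 model `JointModel.Induced.prototypeDatum p` (p446419: transports at EVERY point, `nonempty_transport`): the Witt law
  FAILS there (`JointModel.Induced.not_teichFrob_of_transports`, by `exact` from §2; the author's own witness is `frob_teich_p_ne_teich`) —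
  so the two models of record sit on the two sides of the boundary of §2, as they must.
[folklore] consequences of typed hypotheses; no claim about Joshi's or Mochizuki's mathematics.
-/

noncomputable section

namespace Summit.ABC.IUTFork.Joshi

namespace PeriodRingDatum

variable {F B E0 : Type} [Field F] [CommRing B] [Field E0] {Y : Type} {K : Y → Type} [∀ y, Field (K y)] {G : Type}
  (D : PeriodRingDatum F B E0 Y K G)

/-! ## 1. Under `hφ`, a transport forbids `ϕ`-fixed and `ϕ`-periodic points -/

/-- **No `ϕ`-fixed point carries a §10.13 transport under the Witt–Teichmüller law**: `scale (ϕ y) = p · scale y` (E-t7's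
`scale_frobY_of_transport`) at a fixed point reads `scale y = p · scale y`, contradicting `scale y > 0` and `p ≥ 2`.
[claim: Joshi2023ATS2Local, status: disputed] -/
theorem isEmpty_frobeniusTransport_of_frobY_eq (hφ : ∀ a : F, D.frob (D.teich a) = D.teich (a ^ D.p)) {y : Y}
    (hy : D.frobY y = y) : IsEmpty (D.FrobeniusTransport y) := by
  refine ⟨fun T => ?_⟩
  have h := scale_frobY_of_transport T hφ
  rw [hy] at h
  have hp : (1 : ℝ) < (D.p : ℝ) := by exact_mod_cast D.p_prime.one_lt
  have hs := D.scale_pos y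
  nlinarith

/-- Along iterates: if EVERY point carries a transport and `hφ` holds, `scale (ϕ^[k] y) = p^k · scale y`. [claim: Joshi2023ATS2Local, status: disputed] -/
theorem scale_frobY_iterate_of_transport (hT : ∀ y, Nonempty (D.FrobeniusTransport y))
    (hφ : ∀ a : F, D.frob (D.teich a) = D.teich (a ^ D.p)) (y : Y) (k : ℕ) :
    D.scale (D.frobY^[k] y) = (D.p : ℝ) ^ k * D.scale y := by
  induction k with
  | zero => simp
  | succ k ih =>
    rw [Function.iterate_succ_apply', scale_frobY_of_transport (hT _).some hφ, ih, pow_succ]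
    ring

/-- **`ϕ` has no periodic point** on the carrier of a datum with transports everywhere and `hφ`: `ϕ^[k] y = y ⟹ k = 0` — the typed
counterpart of §6.6's fibre description «`{([ϕⁿ(t)] − p) : n ∈ ℤ}`» (p. 16 l. 27–40), DERIVED from §10.13 + the Witt law.
[claim: Joshi2023ATS2Local, status: disputed] -/
theorem frobY_iterate_ne_self_of_transport (hT : ∀ y, Nonempty (D.FrobeniusTransport y))
    (hφ : ∀ a : F, D.frob (D.teich a) = D.teich (a ^ D.p)) (y : Y) {k : ℕ} (hk : k ≠ 0) : D.frobY^[k] y ≠ y := by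
  intro h
  have hsc := D.scale_frobY_iterate_of_transport hT hφ y k
  rw [h] at hsc
  have hp : (1 : ℝ) < (D.p : ℝ) ^ k := one_lt_pow₀ (by exact_mod_cast D.p_prime.one_lt) hk
  have hs := D.scale_pos y
  nlinarith

/-! ## 2. The signature's junk fixed points `pt 0`, `pt 1`; the joint unsatisfiability -/

/-- The junk value `pt 0` is `ϕ`-fixed (`pt_frob` at `a = 0`: `0^p = 0`; companion of E-t2's `frobY_pt_one`). [folklore] -/
theorem frobY_pt_zero : D.frobY (D.pt 0) = D.pt 0 := by
  rw [← D.pt_frob, zero_pow D.p_prime.ne_zero]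

/-- `pt 0` is not a classical point (print's `|Y_{F,ℚ_p}|` has no `ϕ`-fixed point, E-t2's `frobY_ne_self_of_mem_classicalPts`). [folklore] -/
theorem pt_zero_not_mem_classicalPts : D.pt 0 ∉ D.classicalPts :=
  fun h => D.frobY_ne_self_of_mem_classicalPts h D.frobY_pt_zero

/-- Under `hφ`, the junk point `pt 1` carries NO §10.13 transport — for EVERY datum of the signature. [claim: Joshi2023ATS2Local, status: disputed] -/
theorem isEmpty_frobeniusTransport_pt_one (hφ : ∀ a : F, D.frob (D.teich a) = D.teich (a ^ D.p)) :
    IsEmpty (D.FrobeniusTransport (D.pt 1)) :=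
  D.isEmpty_frobeniusTransport_of_frobY_eq hφ D.frobY_pt_one

/-- Under `hφ`, the junk point `pt 0` carries NO §10.13 transport — for EVERY datum of the signature. [claim: Joshi2023ATS2Local, status: disputed] -/
theorem isEmpty_frobeniusTransport_pt_zero (hφ : ∀ a : F, D.frob (D.teich a) = D.teich (a ^ D.p)) :
    IsEmpty (D.FrobeniusTransport (D.pt 0)) :=
  D.isEmpty_frobeniusTransport_of_frobY_eq hφ D.frobY_pt_zero

/-- **LOCATED SIGNATURE ARTEFACT (kernel, every datum)**: «a §10.13 transport at EVERY point of the carrier type `Y`» and «the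
Witt–Teichmüller law `ϕ([a]) = [a^p]` for all `a`» are jointly UNSATISFIABLE over the typed signature — the total `pt`/`pt_frob`
manufacture the `ϕ`-fixed junk point `pt 1`, where §1 applies. The print-shaped consistent form asks transports on `classicalPts` only.
[claim: Joshi2023ATS2Local, status: disputed] -/
theorem not_teichFrob_of_transport_everywhere (hT : ∀ y, Nonempty (D.FrobeniusTransport y)) :
    ¬ ∀ a : F, D.frob (D.teich a) = D.teich (a ^ D.p) := fun hφ =>
  (D.isEmpty_frobeniusTransport_pt_one hφ).false (hT _).some

/-- Contrapositive packaging: a datum satisfying the Witt–Teichmüller law has a point WITHOUT transport (namely `pt 1`). [claim: Joshi2023ATS2Local, status: disputed] -/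
theorem exists_isEmpty_frobeniusTransport_of_teichFrob (hφ : ∀ a : F, D.frob (D.teich a) = D.teich (a ^ D.p)) :
    ∃ y : Y, IsEmpty (D.FrobeniusTransport y) :=
  ⟨D.pt 1, D.isEmpty_frobeniusTransport_pt_one hφ⟩

/-- … and that point lies OUTSIDE print's locus `|Y_{F,ℚ_p}|` (the obstruction is a junk-point artefact of the typing, not a statement
about classical points). [claim: Joshi2023ATS2Local, status: disputed] -/
theorem exists_isEmpty_frobeniusTransport_not_mem_classicalPts (hφ : ∀ a : F, D.frob (D.teich a) = D.teich (a ^ D.p)) :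
    ∃ y : Y, y ∉ D.classicalPts ∧ IsEmpty (D.FrobeniusTransport y) :=
  ⟨D.pt 1, D.pt_one_not_mem_classicalPts, D.isEmpty_frobeniusTransport_pt_one hφ⟩

end PeriodRingDatum

/-! ## 3. At E-t52's model of record (`hφ` holds there): no transport at its junk points -/

namespace TeichFrobModel

variable (p : ℕ) [hp : Fact p.Prime]

/-- In `TeichFrobModel.datum p` (`ϕ([a]) = [a^p]` by construction, transports exhibited at the column points `Sum.inr (n+1)`), the junk
point `pt 1 = Sum.inl 1` carries NO §10.13 transport. [folklore] -/
theorem isEmpty_transport_pt_one : IsEmpty ((datum p).FrobeniusTransport ((datum p).pt 1)) :=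
  (datum p).isEmpty_frobeniusTransport_pt_one (frob_teich p)

/-- … nor does `pt 0 = Sum.inl 0`. [folklore] -/
theorem isEmpty_transport_pt_zero : IsEmpty ((datum p).FrobeniusTransport ((datum p).pt 0)) :=
  (datum p).isEmpty_frobeniusTransport_pt_zero (frob_teich p)

/-- Hence the model does NOT carry a transport at every point of its carrier (consistent with §2: it carries `hφ`). [folklore] -/
theorem not_forall_nonempty_transport : ¬ ∀ y, Nonempty ((datum p).FrobeniusTransport y) := fun h =>
  (datum p).not_teichFrob_of_transport_everywhere h (frob_teich p)

end TeichFrobModel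

/-! ## 4. At E-t7 g5's W5 model (transports everywhere): the Witt–Teichmüller law fails there, by §2 -/

namespace JointModel.Induced

variable (p : ℕ) [hp : Fact p.Prime]

/-- In `JointModel.Induced.prototypeDatum p` (p446419: `EtaPtTeich` ∧ bijective `ϕ` ∧ a §10.13 transport at EVERY point), the
Witt–Teichmüller law `ϕ([a]) = [a^p]` FAILS — forced by §2 (`pt 1 = [1]` is `ϕ`-fixed and carries a transport); the author's concrete
witness is `frob_teich_p_ne_teich`. [folklore] -/
theorem not_teichFrob_of_transports :
    ¬ ∀ a : PadicAlgCl p, (prototypeDatum p).frob ((prototypeDatum p).teich a) = (prototypeDatum p).teich (a ^ (prototypeDatum p).p) :=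
  (prototypeDatum p).not_teichFrob_of_transport_everywhere (nonempty_transport p)

/-- Equivalently: the junk point `[1]` of the W5 model is where any Witt-law datum would lose its transport. [folklore] -/
theorem transport_pt_one_and_not_teichFrob :
    Nonempty ((prototypeDatum p).FrobeniusTransport ((prototypeDatum p).pt 1)) ∧
      ¬ ∀ a : PadicAlgCl p, (prototypeDatum p).frob ((prototypeDatum p).teich a) = (prototypeDatum p).teich (a ^ (prototypeDatum p).p) :=
  ⟨nonempty_transport p _, not_teichFrob_of_transports p⟩

end JointModel.Induced

end Summit.ABC.IUTFork.Joshi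

end
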